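import Summits.HodgeConjecture.HodgeConjecture.Theorems.LinearSystemTorelliLocalTubeSpanFrameLiftBasic

/-!
# Route LinearSystemTorelli — crux `LocalTubeSpan` (stmt-HodgeConjecture-2490): the elementary level-2 elements are monodromy

Helper file (`--supports stmt-HodgeConjecture-2490`, line `Sketch` of the crux chain, cycle 7,
continuation lead c6; stub `stub_sp2Elementary`).

For a skew vanishing lattice `Δ` of an alternating form `B` on a finite-dimensional `ℚ`-space `V`
(`ℤΔ := Submodule.span ℤ Δ`, `Γ_Δ = transvectionGroup B Δ`), granting Janssen's Theorem 2.5
(`Janssen1983_thm2_5`: a unit of `End V` which is an isometry of `B`, preserves `ℤΔ` both ways,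
and satisfies Schnell's displayed `Sp♯₂`-condition `l (g x - x) = 2 B(v, x)` lies in `Γ_Δ`), the
two ELEMENTARY families of the level-2 congruence subgroup lie in `Γ_Δ`:

* `localTubeSpan_sp2Unipotent_mem` — the common mechanism: for a `ℚ`-linear `N` with `N ∘ N = 0`,
  `B(Nx, y) + B(x, Ny) = 0`, `B(Nx, Ny) = 0`, `N(ℤΔ) ⊆ ℤΔ`, and `l ∘ N = B(v, ·)` on `ℤΔ` for some
  `v ∈ ℤΔ` whenever `l` is integral on `ℤΔ`, the unit `1 + 2N` (inverse `1 - 2N`) lies in `Γ_Δ`;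
* `localTubeSpan_sp2Pair_mem` — for `e, f ∈ ℤΔ` with `B(e, f) = 0`, some `g ∈ Γ_Δ` acts as
  `x ↦ x + 2 (B(x, e) f + B(x, f) e)`;
* `localTubeSpan_sp2Square_mem` — for `a ∈ ℤΔ`, some `g ∈ Γ_Δ` acts as `T_a²`,
  `x ↦ x - 2 B(x, a) a`;
* `localTubeSpan_sp2Elementary` — the conjunction (the registered stub signature).

Named fact used: `Janssen1983_thm2_5` (hypothesis `h25`); no `sorry`.
-/

-- `Summit.HodgeConjecture.HodgeConjecture.Theorems` is the mandated namespace (single-conjunct summit: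
-- Sub = Summit), which `linter.dupNamespace` flags on every declaration; the lakefile turns the
-- linter off tree-wide (weak option), restated here so stand-alone elaboration is warning-free too.
set_option linter.dupNamespace false

noncomputable section

open Literature.AlgebraicGeometry.HodgeTheory

namespace Summit.HodgeConjecture.HodgeConjecture.Theorems

/-! ### Elementary elements of the level-2 congruence subgroup -/

section Sp2Elementary

variable {V : Type} [AddCommGroup V] [Module ℚ V]

/-- Integrality of `B` on `Δ × Δ` propagates to `ℤΔ × ℤΔ`. [folklore] -/
theorem localTubeSpan_exists_int_eq_of_mem_span_int_of_mem_span_int (B : LinearMap.BilinForm ℚ V)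
    (Δ : Set V) (hint : ∀ δ ∈ Δ, ∀ δ' ∈ Δ, ∃ n : ℤ, B δ δ' = n)
    {y : V} (hy : y ∈ Submodule.span ℤ Δ) {z : V} (hz : z ∈ Submodule.span ℤ Δ) :
    ∃ n : ℤ, B y z = n := by
  refine localTubeSpan_exists_int_eq_of_mem_span_int B Δ z ?_ hy
  intro δ hδ
  obtain ⟨n, hn⟩ := localTubeSpan_exists_int_eq_of_mem_span_int B.flip Δ δ
    (fun δ' hδ' => by
      obtain ⟨n, hn⟩ := hint δ hδ δ' hδ'
      exact ⟨n, by rw [LinearMap.BilinForm.flip_apply, hn]⟩) hz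
  exact ⟨n, by rw [← hn, LinearMap.BilinForm.flip_apply]⟩

/-- A rational multiple `q • y` with `q` the cast of an integer and `y ∈ ℤΔ` lies in `ℤΔ`.
[folklore] -/
theorem localTubeSpan_cast_smul_mem_span_int (Δ : Set V) {q : ℚ} (hq : ∃ n : ℤ, q = n) {y : V}
    (hy : y ∈ Submodule.span ℤ Δ) : q • y ∈ Submodule.span ℤ Δ := by
  obtain ⟨n, rfl⟩ := hq
  rw [Int.cast_smul_eq_zsmul]
  exact Submodule.smul_mem _ n hy

/-- **Unipotent elements of index two are monodromy, granting Janssen's Theorem 2.5.**  Let `Δ` be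
a skew vanishing lattice of the alternating form `B` (finite-dimensional `V`) and `N : V → V` a
`ℚ`-linear map with `N ∘ N = 0`, infinitesimally isometric (`B(Nx, y) + B(x, Ny) = 0`) with
isotropic image (`B(Nx, Ny) = 0`), preserving `ℤΔ`, and such that for every functional `l` integral
on `ℤΔ` there is `v ∈ ℤΔ` with `l(Nx) = B(v, x)` on `ℤΔ`.  Then the unit `g = 1 + 2N` (inverse
`1 - 2N`) is an isometry preserving `ℤΔ` both ways with `l(gx - x) = 2 B(v, x)`, so lies in `Γ_Δ`
by Theorem 2.5. [cite: Schnell2010, §7 Thm. 10] -/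
theorem localTubeSpan_sp2Unipotent_mem (h25 : Janssen1983_thm2_5) [FiniteDimensional ℚ V]
    (B : LinearMap.BilinForm ℚ V) (hB : B.IsAlt) (Δ : Set V) (hΔ : IsSkewVanishingLattice B Δ)
    (N : V →ₗ[ℚ] V) (hNN : ∀ x, N (N x) = 0)
    (hskew : ∀ x y, B (N x) y + B x (N y) = 0) (hiso : ∀ x y, B (N x) (N y) = 0)
    (hpres : ∀ x ∈ Submodule.span ℤ Δ, N x ∈ Submodule.span ℤ Δ)
    (hsp2 : ∀ l : V →ₗ[ℚ] ℚ, (∀ x ∈ Submodule.span ℤ Δ, ∃ z : ℤ, l x = z) →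
      ∃ v ∈ Submodule.span ℤ Δ, ∀ x ∈ Submodule.span ℤ Δ, l (N x) = B v x) :
    ∃ g ∈ transvectionGroup B Δ, ∀ x : V,
      ((g : (V →ₗ[ℚ] V)ˣ) : V →ₗ[ℚ] V) x = x + (2 : ℚ) • N x := by
  -- the unit `g = 1 + 2N`, `g⁻¹ = 1 - 2N`
  let g : (V →ₗ[ℚ] V)ˣ :=
    { val := LinearMap.id + (2 : ℚ) • N
      inv := LinearMap.id - (2 : ℚ) • N
      val_inv := LinearMap.ext fun x => by
        have e1 : N (x - (2 : ℚ) • N x) = N x := by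
          rw [map_sub, map_smul, hNN, smul_zero, sub_zero]
        rw [Module.End.mul_apply, Module.End.one_apply, LinearMap.sub_apply, LinearMap.add_apply,
          LinearMap.smul_apply, LinearMap.smul_apply, LinearMap.id_apply, LinearMap.id_apply, e1,
          sub_add_cancel]
      inv_val := LinearMap.ext fun x => by
        have e1 : N (x + (2 : ℚ) • N x) = N x := by
          rw [map_add, map_smul, hNN, smul_zero, add_zero]
        rw [Module.End.mul_apply, Module.End.one_apply, LinearMap.add_apply, LinearMap.sub_apply,
          LinearMap.smul_apply, LinearMap.smul_apply, LinearMap.id_apply, LinearMap.id_apply, e1,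
          add_sub_cancel_right] }
  have hg : ∀ x, ((g : (V →ₗ[ℚ] V)ˣ) : V →ₗ[ℚ] V) x = x + (2 : ℚ) • N x := fun x => rfl
  have hg' : ∀ x, ((g⁻¹ : (V →ₗ[ℚ] V)ˣ) : V →ₗ[ℚ] V) x = x - (2 : ℚ) • N x := fun x => rfl
  have h2 : ∀ {y : V}, y ∈ Submodule.span ℤ Δ → (2 : ℚ) • y ∈ Submodule.span ℤ Δ :=
    fun hy => by rw [two_smul]; exact Submodule.add_mem _ hy hy
  refine ⟨g, h25 V B hB Δ hΔ g ?_ ?_ ?_ ?_, hg⟩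
  · -- isometry
    intro x y
    have h1 := hskew x y
    have h3 := hiso x y
    rw [hg, hg]
    simp only [map_add, map_smul, LinearMap.add_apply, LinearMap.smul_apply, smul_eq_mul]
    linear_combination (2 : ℚ) * h1 + 4 * h3
  · -- `g` preserves `ℤΔ`
    intro x hx
    rw [hg]
    exact Submodule.add_mem _ hx (h2 (hpres x hx))
  · -- `g⁻¹` preserves `ℤΔ`
    intro x hx
    rw [hg']
    exact Submodule.sub_mem _ hx (h2 (hpres x hx))
  · -- Schnell's displayed `Sp♯₂` condition
    intro l hl
    obtain ⟨v, hv, hvx⟩ := hsp2 l hl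
    refine ⟨v, hv, fun x hx => ?_⟩
    rw [hg, add_sub_cancel_left, map_smul, smul_eq_mul, hvx x hx]

/-- **Squared transvection pairs are monodromy** (granting Theorem 2.5): for `e, f ∈ ℤΔ` with
`B(e, f) = 0` some `g ∈ Γ_Δ` acts as `x ↦ x + 2 (B(x, e) f + B(x, f) e)`.  (`N x = B(x,e) f + B(x,f) e`
has `N² = 0` and isotropic image since `B` vanishes on `span {e, f}`, is infinitesimally isometric
by skew-symmetry, preserves `ℤΔ` by integrality, and `l(Nx) = B(v, x)` for
`v = -(l(f) e + l(e) f) ∈ ℤΔ`.) [cite: Schnell2010, §7 Thm. 10] -/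
theorem localTubeSpan_sp2Pair_mem (h25 : Janssen1983_thm2_5) [FiniteDimensional ℚ V]
    (B : LinearMap.BilinForm ℚ V) (hB : B.IsAlt) (Δ : Set V) (hΔ : IsSkewVanishingLattice B Δ)
    {e : V} (he : e ∈ Submodule.span ℤ Δ) {f : V} (hf : f ∈ Submodule.span ℤ Δ) (hef : B e f = 0) :
    ∃ g ∈ transvectionGroup B Δ, ∀ x : V,
      ((g : (V →ₗ[ℚ] V)ˣ) : V →ₗ[ℚ] V) x = x + (2 : ℚ) • (B x e • f + B x f • e) := by
  have hfe : B f e = 0 := by rw [← hB.neg_eq, hef, neg_zero]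
  have hee : B e e = 0 := hB.self_eq_zero e
  have hff : B f f = 0 := hB.self_eq_zero f
  let N : V →ₗ[ℚ] V := (B.flip e).smulRight f + (B.flip f).smulRight e
  have hN : ∀ x, N x = B x e • f + B x f • e := fun x => rfl
  -- `N ∘ N = 0`
  have hNN : ∀ x, N (N x) = 0 := fun x => by
    rw [hN, hN]
    simp only [map_add, map_smul, LinearMap.add_apply, LinearMap.smul_apply, smul_eq_mul, hfe, hef,
      hee, hff, mul_zero, add_zero, zero_smul]
  -- infinitesimal isometry
  have hskew : ∀ x y, B (N x) y + B x (N y) = 0 := fun x y => by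
    have h1 : B f y = -B y f := (hB.neg_eq y f).symm
    have h2 : B e y = -B y e := (hB.neg_eq y e).symm
    rw [hN, hN]
    simp only [map_add, map_smul, LinearMap.add_apply, LinearMap.smul_apply, smul_eq_mul, h1, h2]
    ring
  -- isotropic image
  have hiso : ∀ x y, B (N x) (N y) = 0 := fun x y => by
    rw [hN, hN]
    simp only [map_add, map_smul, LinearMap.add_apply, LinearMap.smul_apply, smul_eq_mul, hfe, hef,
      hee, hff, mul_zero, add_zero]
  -- `N` preserves `ℤΔ`
  have hpres : ∀ x ∈ Submodule.span ℤ Δ, N x ∈ Submodule.span ℤ Δ := fun x hx => by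
    rw [hN]
    exact Submodule.add_mem _
      (localTubeSpan_cast_smul_mem_span_int Δ
        (localTubeSpan_exists_int_eq_of_mem_span_int_of_mem_span_int B Δ hΔ.integral hx he) hf)
      (localTubeSpan_cast_smul_mem_span_int Δ
        (localTubeSpan_exists_int_eq_of_mem_span_int_of_mem_span_int B Δ hΔ.integral hx hf) he)
  -- the `Sp♯₂` vector `v = -(l f • e + l e • f)`
  have hsp2 : ∀ l : V →ₗ[ℚ] ℚ, (∀ x ∈ Submodule.span ℤ Δ, ∃ z : ℤ, l x = z) →
      ∃ v ∈ Submodule.span ℤ Δ, ∀ x ∈ Submodule.span ℤ Δ, l (N x) = B v x := fun l hl => by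
    refine ⟨-(l f • e + l e • f), Submodule.neg_mem _ (Submodule.add_mem _
      (localTubeSpan_cast_smul_mem_span_int Δ (hl f hf) he)
      (localTubeSpan_cast_smul_mem_span_int Δ (hl e he) hf)), fun x _ => ?_⟩
    have h1 : B e x = -B x e := (hB.neg_eq x e).symm
    have h2 : B f x = -B x f := (hB.neg_eq x f).symm
    rw [hN]
    simp only [map_add, map_smul, map_neg, LinearMap.add_apply, LinearMap.smul_apply,
      LinearMap.neg_apply, smul_eq_mul, h1, h2]
    ring
  obtain ⟨g, hg, hgx⟩ := localTubeSpan_sp2Unipotent_mem h25 B hB Δ hΔ N hNN hskew hiso hpres hsp2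
  exact ⟨g, hg, fun x => by rw [hgx x, hN]⟩

/-- **Squares of transvections along lattice vectors are monodromy** (granting Theorem 2.5): for
`a ∈ ℤΔ` some `g ∈ Γ_Δ` acts as `T_a² : x ↦ x - 2 B(x, a) a`.  (`N x = -B(x, a) a` has `N² = 0`,
isotropic image, is infinitesimally isometric, preserves `ℤΔ`, and `l(Nx) = B(l(a) a, x)`.)
[cite: Schnell2010, §7 Thm. 10] -/
theorem localTubeSpan_sp2Square_mem (h25 : Janssen1983_thm2_5) [FiniteDimensional ℚ V]
    (B : LinearMap.BilinForm ℚ V) (hB : B.IsAlt) (Δ : Set V) (hΔ : IsSkewVanishingLattice B Δ)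
    {a : V} (ha : a ∈ Submodule.span ℤ Δ) :
    ∃ g ∈ transvectionGroup B Δ, ∀ x : V,
      ((g : (V →ₗ[ℚ] V)ˣ) : V →ₗ[ℚ] V) x = x - (2 : ℚ) • (B x a • a) := by
  have haa : B a a = 0 := hB.self_eq_zero a
  let N : V →ₗ[ℚ] V := -((B.flip a).smulRight a)
  have hN : ∀ x, N x = -(B x a • a) := fun x => rfl
  -- `N ∘ N = 0`
  have hNN : ∀ x, N (N x) = 0 := fun x => by
    rw [hN, hN]
    simp only [map_neg, map_smul, LinearMap.neg_apply, LinearMap.smul_apply, smul_eq_mul, haa,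
      mul_zero, neg_zero, zero_smul]
  -- infinitesimal isometry
  have hskew : ∀ x y, B (N x) y + B x (N y) = 0 := fun x y => by
    have h1 : B a y = -B y a := (hB.neg_eq y a).symm
    rw [hN, hN]
    simp only [map_neg, map_smul, LinearMap.neg_apply, LinearMap.smul_apply, smul_eq_mul, h1]
    ring
  -- isotropic image
  have hiso : ∀ x y, B (N x) (N y) = 0 := fun x y => by
    rw [hN, hN]
    simp only [map_neg, map_smul, LinearMap.neg_apply, LinearMap.smul_apply, smul_eq_mul, haa,
      mul_zero, neg_zero]
  -- `N` preserves `ℤΔ`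
  have hpres : ∀ x ∈ Submodule.span ℤ Δ, N x ∈ Submodule.span ℤ Δ := fun x hx => by
    rw [hN]
    exact Submodule.neg_mem _ (localTubeSpan_cast_smul_mem_span_int Δ
      (localTubeSpan_exists_int_eq_of_mem_span_int_of_mem_span_int B Δ hΔ.integral hx ha) ha)
  -- the `Sp♯₂` vector `v = l a • a`
  have hsp2 : ∀ l : V →ₗ[ℚ] ℚ, (∀ x ∈ Submodule.span ℤ Δ, ∃ z : ℤ, l x = z) →
      ∃ v ∈ Submodule.span ℤ Δ, ∀ x ∈ Submodule.span ℤ Δ, l (N x) = B v x := fun l hl => by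
    refine ⟨l a • a, localTubeSpan_cast_smul_mem_span_int Δ (hl a ha) ha, fun x _ => ?_⟩
    have h1 : B a x = -B x a := (hB.neg_eq x a).symm
    rw [hN]
    simp only [map_neg, map_smul, LinearMap.smul_apply, smul_eq_mul, h1]
    ring
  obtain ⟨g, hg, hgx⟩ := localTubeSpan_sp2Unipotent_mem h25 B hB Δ hΔ N hNN hskew hiso hpres hsp2
  exact ⟨g, hg, fun x => by rw [hgx x, hN, smul_neg, sub_eq_add_neg]⟩

/-- **The elementary level-2 elements are monodromy, granting Janssen's Theorem 2.5** (stub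
`stub_sp2Elementary` of line `Sketch`, cycle 7).  For a skew vanishing lattice `Δ` (alternating `B`,
finite-dimensional `V`): (i) for `e, f ∈ ℤΔ` with `B(e, f) = 0` some `g ∈ Γ_Δ` acts as
`x ↦ x + 2 (B(x,e) f + B(x,f) e)`; (ii) for `a ∈ ℤΔ` some `g ∈ Γ_Δ` acts as `T_a²`,
`x ↦ x - 2 B(x,a) a`. [cite: Schnell2010, §7 Thm. 10] -/
theorem localTubeSpan_sp2Elementary (h25 : Janssen1983_thm2_5) [FiniteDimensional ℚ V]
    (B : LinearMap.BilinForm ℚ V) (hB : B.IsAlt) (Δ : Set V) (hΔ : IsSkewVanishingLattice B Δ) :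
    (∀ e ∈ Submodule.span ℤ Δ, ∀ f ∈ Submodule.span ℤ Δ, B e f = 0 →
      ∃ g ∈ transvectionGroup B Δ, ∀ x : V,
        ((g : (V →ₗ[ℚ] V)ˣ) : V →ₗ[ℚ] V) x = x + (2 : ℚ) • (B x e • f + B x f • e)) ∧
    (∀ a ∈ Submodule.span ℤ Δ, ∃ g ∈ transvectionGroup B Δ, ∀ x : V,
        ((g : (V →ₗ[ℚ] V)ˣ) : V →ₗ[ℚ] V) x = x - (2 : ℚ) • (B x a • a)) :=
  ⟨fun _ he _ hf hef => localTubeSpan_sp2Pair_mem h25 B hB Δ hΔ he hf hef,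
    fun _ ha => localTubeSpan_sp2Square_mem h25 B hB Δ hΔ ha⟩

end Sp2Elementary

end Summit.HodgeConjecture.HodgeConjecture.Theorems

end
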